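import Summits.ResolutionOfSingularities.ResolutionOfSingularities.Theorems.EquisingularLiftEquisingularLiftNatCurvilinearMultisection
import Summits.ResolutionOfSingularities.ResolutionOfSingularities.Theorems.EquisingularLiftEquisingularLiftNatCarrierDeltaComapFrame
import HarnessLib

/-!
# [OURS · L1 W4.5(b) · EL♮(3)] Rung TOWER₀, (pt-ram) supplier — MODEL-SQUARE FORM of the prescribed-trace multisection
# (crux `EquisingularLiftNatThree` = stmt-ResolutionOfSingularities-20148 / `EquisingularLiftNat` = stmt-…-20038)

HONEST FRAMING. OURS (cell res-hironaka, crux chain w45b, slot W4.5(b)); NOT a statement of any manuscript; AI-written, weaker than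
expert review. Helper `--supports stmt-ResolutionOfSingularities-20148 --as helper`; closes nothing. `exists_multisection_comap_eq_of_model`
= `exists_multisection_comap_eq` (…NatCurvilinearMultisection, p547075) with its model-square side conditions DISCHARGED in the binders of
the HSUB′ suppliers (res-L1-w45b-stub-1 / res-type-100 model square `IsPullback j t r' (Spec θ)`): injectivity of `j` and «`r' ∘ j` hits the
closed point» (from the pullback square), surjectivity of `j^♯_x` (`stalkMap_model_surjective`, …NatCarrierDeltaComapFrame p533xxx-class) and
`ker j^♯_x ≤ (ϖ)` (`ker_stalkMap_model_le`, same file; germ spellings bridged by `stalkMap_Γgerm_apply'`). What the caller still supplies: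
regularity + dimension of `𝒪_{X', j x}`, the residue-field clause `hres` (the point is `k`-rational), the cotangent-independent generators of
`J_x`, and «`J_x` is `𝔪`-primary» (= `supp J = {x}` read in an affine chart).
-/

set_option linter.dupNamespace false -- mandated namespace `Summit.<Summit>.<Problem>` of this single-conjunct summit

noncomputable section

universe u

open CategoryTheory AlgebraicGeometry TopologicalSpace IsLocalRing
open Literature.AlgebraicGeometry.Resolution

namespace Summit.ResolutionOfSingularities.ResolutionOfSingularities.Cruxes.EquisingularLiftNat.Sections

/-- **Prescribed-trace multisection, model-square form** (see the module docstring). [OURS · L1 W4.5b; folklore assembly] -/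
theorem exists_multisection_comap_eq_of_model (O : Type) [CommRing O] [IsDomain O] [IsDiscreteValuationRing O]
    [IsAdicComplete (maximalIdeal O) O] (k : Type) [Field k] (θ : O →+* k) (hθ : Function.Surjective θ)
    {X' F₁ : Scheme.{0}} (r' : X' ⟶ Spec (.of O)) [IsProper r'] (j : F₁ ⟶ X') (t : F₁ ⟶ Spec (.of k))
    (hsq : IsPullback j t r' (Spec.map (CommRingCat.ofHom θ))) (x : F₁)
    (hres : Function.Surjective ((residue (X'.presheaf.stalk (j x))).comp ((Scheme.ΓSpecIso (.of O)).inv ≫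
      (Spec (.of O)).presheaf.germ ⊤ (r' (j x)) trivial ≫ r'.stalkMap (j x)).hom))
    {d : ℕ} (hd : ringKrullDim (X'.presheaf.stalk (j x)) = (d + 1 : ℕ))
    (hreg : IsRegularLocalRing (X'.presheaf.stalk (j x)))
    (J : F₁.IdealSheafData) (hJsupp : (J.support : Set F₁) = {x})
    (ℓ : Fin d → F₁.presheaf.stalk x) (hℓ : ∀ i, ℓ i ∈ maximalIdeal (F₁.presheaf.stalk x))
    (hJ : stalkIdeal J x = Ideal.span (Set.range ℓ))
    (hli : LinearIndependent (ResidueField (F₁.presheaf.stalk x)) fun i => (maximalIdeal (F₁.presheaf.stalk x)).toCotangent ⟨ℓ i, hℓ i⟩)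
    (ϖ : O) (hϖ : Irreducible ϖ)
    (hprim : ∃ N : ℕ, maximalIdeal (F₁.presheaf.stalk x) ^ N ≤ stalkIdeal J x) :
    ∃ C : X'.IdealSheafData, Scheme.IsRegular C.subscheme ∧ Flat (CategoryStruct.comp C.subschemeι r') ∧
      (C.support : Set X') ∩ r' ⁻¹' {closedPoint O} = {j x} ∧ C.comap j = J := by
  haveI : IsClosedImmersion (Spec.map (CommRingCat.ofHom θ)) := IsClosedImmersion.spec_of_surjective _ hθ
  haveI : IsClosedImmersion j := MorphismProperty.IsStableUnderBaseChange.of_isPullback hsq.flip inferInstance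
  have hjinj : Function.Injective j := j.isClosedEmbedding.injective
  have hGs : ∀ y : F₁, r' (j y) = closedPoint O := by
    intro y
    have hy : j y ∈ Set.range j := ⟨y, rfl⟩
    rw [range_eq_preimage_of_isPullback hsq, range_specMap_of_surjective_of_field θ hθ] at hy
    exact hy
  have hsurj := stalkMap_model_surjective θ hθ r' j t hsq x
  -- `ker j^♯_x ≤ (ϖ)` in the germ spelling of the multisection kit
  have hker : RingHom.ker (j.stalkMap x).hom ≤ Ideal.span {((Scheme.ΓSpecIso (.of O)).inv ≫
      (Spec (.of O)).presheaf.germ ⊤ (r' (j x)) trivial ≫ r'.stalkMap (j x)).hom ϖ} := by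
    have h := ker_stalkMap_model_le O k θ hθ r' j t hsq x ϖ hϖ
    have hbridge : (X'.presheaf.Γgerm (j x)).hom (r'.appTop.hom ((Scheme.ΓSpecIso (.of O)).inv.hom ϖ)) =
        ((Scheme.ΓSpecIso (.of O)).inv ≫ (Spec (.of O)).presheaf.germ ⊤ (r' (j x)) trivial ≫ r'.stalkMap (j x)).hom ϖ := by
      rw [← Summit.ResolutionOfSingularities.ResolutionOfSingularities.Cruxes.EquisingularLift.StrataSplit.stalkMap_Γgerm_apply' r' (j x)]
      rfl
    rwa [hbridge] at h
  exact exists_multisection_comap_eq r' j hjinj hGs x hsurj hres hd hreg J hJsupp ℓ hℓ hJ hli hϖ hker hprim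

end Summit.ResolutionOfSingularities.ResolutionOfSingularities.Cruxes.EquisingularLiftNat.Sections

end
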